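import Mathlib.Algebra.Polynomial.Coeff
import Mathlib.Algebra.Polynomial.Eval.Defs
import Mathlib.RingTheory.Nilpotent.Basic
import Summits.Ventures.HSemireg.EmbeddedFirstOrderDeformationsTorsor

/-!
# Venture HSemireg — a WITNESS: local flat lifts need not exist (the hypothesis «extensions of `Y` exist locally» of
# Hartshorne's Thm. 6.2 (b) — the binder `hT` of the Čech files — is NOT automatic off the formally smooth case)

HONEST FRAMING.  Lean side of the computation cell `pub-hsemireg` (track «S4-PUSH» (ii), seat s4-prove-3 g6, second
route for (S5)); log `s4push/prove-3/ATTEMPT-10.md` §5.  A two-line commutative-algebra example; no scheme, sheaf,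
abelian variety or semiregularity map; nothing here says that HC, HC_CM or HC_AV holds; no object is certified; no
Literature fact is declared.

WHAT (namespace `Summit.Ventures.HSemireg.EmbeddedDeformation`).  Over any non-trivial commutative ring `k`:
* `isFirstOrderThickening_truncation` — `π : k[x]/(x⁴) ↠ k[x]/(x²)` with parameter `e = x²` IS a flat first-order
  thickening (`…Torsor`'s `IsFirstOrderThickening`: kernel `(e)`, `e² = 0`, `Ann(e) = (e)` — `{1, x}` is a basis over
  `k[e]/(e²)`): the double point `X = Spec k[x]/(x²)` deformed to first order inside its own square.
* **`not_exists_isLift_truncation`** — the reduced point `Z = V(x̄) ⊂ X` has NO flat lift across `π`: every lift `K`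
  of `(x̄)` contains `x + x²w = x·(unit)`, hence `x`, hence `e = x²`; flatness `(K : e) = K + eR'` then puts
  `1 − e c ∈ K`, so `1 ∈ π(K) = (x̄)` — absurd.  So `∃ K, IsLift π e I K` («extensions exist locally», the `hT` binder of
  `…CechObstruction` / the left side of `…CechAffine`'s criterion) is a genuine hypothesis; `…SmoothSplitting`'s
  `exists_isLift` shows it IS automatic when `R` is formally smooth over the field.
Geometrically: a flat deformation of the reduced point over `D = k[ε]/ε²` is `Spec D`, and a `D`-map
`k[x]/(x⁴) → D` with `x² ↦ ε` would need `x ↦ a + bε`, `a² = 0`, `2abε = ε` — impossible.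

References: R. Hartshorne, *Deformation Theory*, GTM 257 (2010), §6 Thm. 6.2 (b) (hypothesis «if extensions of `Y`
over `C'` exist locally on `X`») [corpus: book:springernd-deformation-theory p0054].
-/

namespace Summit.Ventures.HSemireg

namespace EmbeddedDeformation

open Polynomial

universe u

variable (k : Type u) [CommRing k]

/-- `(x⁴) ≤ (x²)` in `k[x]`. [folklore] -/
theorem span_X_pow_four_le : Ideal.span {(X ^ 4 : k[X])} ≤ Ideal.span {(X ^ 2 : k[X])} := by
  rw [Ideal.span_singleton_le_iff_mem, Ideal.mem_span_singleton]
  exact ⟨X ^ 2, by ring⟩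

/-- **`π : k[x]/(x⁴) ↠ k[x]/(x²)`, `e = x²`, is a flat first-order thickening** (surjective; kernel `(x²)/(x⁴) = (e)`;
`e² = 0`; `Ann(e) ⊆ (e)` because `x²p ∈ (x⁴)` forces `x² ∣ p`, `x` being a non-zero-divisor of `k[x]`). [folklore] -/
theorem isFirstOrderThickening_truncation :
    IsFirstOrderThickening (Ideal.Quotient.factor (span_X_pow_four_le k))
      (Ideal.Quotient.mk (Ideal.span {(X ^ 4 : k[X])}) (X ^ 2)) where
  surjective := Ideal.Quotient.factor_surjective _
  ker_iff z := by
    obtain ⟨p, rfl⟩ := Ideal.Quotient.mk_surjective z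
    rw [Ideal.Quotient.factor_mk, Ideal.Quotient.eq_zero_iff_mem, Ideal.mem_span_singleton]
    constructor
    · rintro ⟨q, rfl⟩
      exact ⟨Ideal.Quotient.mk _ q, by rw [← map_mul]⟩
    · rintro ⟨w, hw⟩
      obtain ⟨q, rfl⟩ := Ideal.Quotient.mk_surjective w
      rw [← map_mul, Ideal.Quotient.eq, Ideal.mem_span_singleton] at hw
      obtain ⟨c, hc⟩ := hw
      exact ⟨q + X ^ 2 * c, by linear_combination hc⟩
  eps_sq := by
    rw [← map_mul, Ideal.Quotient.eq_zero_iff_mem, Ideal.mem_span_singleton]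
    exact ⟨1, by ring⟩
  ann_le z hz := by
    obtain ⟨p, rfl⟩ := Ideal.Quotient.mk_surjective z
    rw [← map_mul, Ideal.Quotient.eq_zero_iff_mem, Ideal.mem_span_singleton] at hz
    obtain ⟨q, hq⟩ := hz
    have hp : p = X ^ 2 * q :=
      (isRegular_X_pow (R := k) 2).left (show X ^ 2 * p = X ^ 2 * (X ^ 2 * q) by rw [hq]; ring)
    exact ⟨Ideal.Quotient.mk _ q, by rw [← map_mul, hp]⟩

variable [Nontrivial k]

/-- `1 ∉ (x̄)` in `k[x]/(x²)` (evaluate `a·x − 1 = x²·b` at `0`). [folklore] -/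
theorem one_not_mem_span_X_truncation :
    (1 : k[X] ⧸ Ideal.span {(X ^ 2 : k[X])}) ∉ Ideal.span {Ideal.Quotient.mk (Ideal.span {(X ^ 2 : k[X])}) X} := by
  intro h
  obtain ⟨a, ha⟩ := Ideal.mem_span_singleton'.1 h
  obtain ⟨A, rfl⟩ := Ideal.Quotient.mk_surjective a
  rw [← map_mul, ← (Ideal.Quotient.mk _).map_one, Ideal.Quotient.eq, Ideal.mem_span_singleton] at ha
  obtain ⟨B, hB⟩ := ha
  have h0 := congrArg (Polynomial.eval 0) hB
  simp only [eval_sub, eval_mul, eval_X, mul_zero, eval_one, zero_sub, eval_pow, ne_eq, OfNat.ofNat_ne_zero,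
    not_false_eq_true, zero_pow, zero_mul] at h0
  exact one_ne_zero (neg_eq_zero.1 h0)

/-- **WITNESS: the reduced point `Z = V(x̄) ⊂ X = Spec k[x]/(x²)` has NO flat lift across the thickening
`π : k[x]/(x⁴) ↠ k[x]/(x²)`** (`e = x²`).  Any lift `K` of `(x̄)` contains some `x + x²w = x(1 + xw)` with `1 + xw` a unit
(`xw` is nilpotent), so `x ∈ K` and `e = x·x ∈ K`; flatness of `K` gives `1 − e c ∈ K`, whence `1 = π(1 − e c) ∈ (x̄)`,
contradicting `one_not_mem_span_X_truncation`.  Hence the hypothesis «local flat lifts `T_α` exist» of the Čech files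
(Hartshorne: «if extensions of `Y` over `C'` exist locally on `X`») is not vacuous-by-default.
[cite: Hartshorne2010, §6 Thm. 6.2 (b)] -/
theorem not_exists_isLift_truncation :
    ¬ ∃ K : Ideal (k[X] ⧸ Ideal.span {(X ^ 4 : k[X])}),
      IsLift (Ideal.Quotient.factor (span_X_pow_four_le k)) (Ideal.Quotient.mk (Ideal.span {(X ^ 4 : k[X])}) (X ^ 2))
        (Ideal.span {Ideal.Quotient.mk (Ideal.span {(X ^ 2 : k[X])}) X}) K := by
  rintro ⟨K, hK⟩
  set R4 := k[X] ⧸ Ideal.span {(X ^ 4 : k[X])}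
  set π := Ideal.Quotient.factor (span_X_pow_four_le k)
  set e : R4 := Ideal.Quotient.mk (Ideal.span {(X ^ 4 : k[X])}) (X ^ 2) with he
  have hT := isFirstOrderThickening_truncation k
  -- a member of `K` over `x̄`
  obtain ⟨z, hzK, hz⟩ := hK.exists_mem _ (Ideal.subset_span rfl)
  obtain ⟨p, rfl⟩ := Ideal.Quotient.mk_surjective z
  rw [Ideal.Quotient.factor_mk, Ideal.Quotient.eq, Ideal.mem_span_singleton] at hz
  obtain ⟨q, hq⟩ := hz
  have hp : p = X * (1 + X * q) := by rw [mul_add, mul_one, ← mul_assoc, ← pow_two, ← hq]; ring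
  -- `1 + x q` is a unit of `k[x]/(x⁴)` (`x q` is nilpotent), so `x ∈ K`
  have hnil : IsNilpotent (Ideal.Quotient.mk (Ideal.span {(X ^ 4 : k[X])}) (X * q)) := by
    refine ⟨4, ?_⟩
    rw [← map_pow, Ideal.Quotient.eq_zero_iff_mem, Ideal.mem_span_singleton]
    exact ⟨q ^ 4, by ring⟩
  obtain ⟨u, hu⟩ := hnil.isUnit_one_add
  have hxK : Ideal.Quotient.mk (Ideal.span {(X ^ 4 : k[X])}) X ∈ K := by
    have h1 : Ideal.Quotient.mk (Ideal.span {(X ^ 4 : k[X])}) p =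
        Ideal.Quotient.mk (Ideal.span {(X ^ 4 : k[X])}) X * (u : R4) := by
      rw [hu, hp, map_mul, map_add, map_one, map_mul]
    have h2 : Ideal.Quotient.mk (Ideal.span {(X ^ 4 : k[X])}) X =
        Ideal.Quotient.mk (Ideal.span {(X ^ 4 : k[X])}) p * (↑u⁻¹ : R4) := by
      rw [h1, mul_assoc, Units.mul_inv, mul_one]
    rw [h2]
    exact K.mul_mem_right _ hzK
  -- hence `e · 1 ∈ K`, and flatness gives `1 - e c ∈ K`
  have heK : e * 1 ∈ K := by
    rw [mul_one, he, pow_two, map_mul]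
    exact K.mul_mem_left _ hxK
  obtain ⟨c, hc⟩ := hK.eps_flat 1 heK
  -- so `1 = π (1 - e c) ∈ (x̄)`: contradiction
  have h1 := hK.map_mem _ hc
  rw [map_sub, map_mul, hT.map_eps, zero_mul, sub_zero, map_one] at h1
  exact one_not_mem_span_X_truncation k h1

end EmbeddedDeformation

end Summit.Ventures.HSemireg
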